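import Literature.MathematicalPhysics.QuantumFieldTheory.Balaban1983to89.AveragingRT
import Literature.MathematicalPhysics.QuantumFieldTheory.Balaban1983to89.T4TreeGaugeFixing

/-!
# `Summit.QuantumFields.Balaban3D.Proofs.Translation13` — [Balaban1985UV3] p. 259, the change of variables of **(12)→(13)** «We make a
# change of variables in the integral over Ω₁ taking U = U′U₁. The new variables U′ are called fluctuation fields, and the minimal
# configuration U₁ is called a background field» (and p. 268 L18–19 «we make the translation V_k = V′_kV_k^{(k)}»): in the tree's
# reading of the gauge-fixed integral (10) (bond variables on the axial forest `T` PRESCRIBED to 1, `T4TreeGaugeFixing.fixTo T 1`, as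
# in p1's `Carriers.Formula10`), translation by a background that is itself axial (`U₁ = 1` on `T`) is an exact identity of Haar
# integrals — lane `pub-balaban3d`, seat p4 (ruling R-DISP: «(49)–(50) ← p4 (tree gauge `fixTo`; translation by Haar invariance)»)

HONEST FRAMING (lane PLAN.md §0, binding): see `…Proofs.SectAFirstStep`.  Right-invariance of the product Haar measure, nothing
of [Balaban1985UV3] beyond the quoted change of variables; the background `U₁` is ANY configuration equal to 1 on the forest (print's
U₁ is the minimizer of (12), «U satisfies axial gauge conditions on Ω₁», binder b11).

WHAT IS PRINTED.  p. 259 = PDF 5 L4–7 (render p005): «We make a change of variables in the integral over Ω₁ taking U = U′U₁. The new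
variables U′ are called fluctuation fields, and the minimal configuration U₁ is called a background field.»; (12) p. 258 L36–37:
«U satisfies axial gauge conditions on Ω₁»; (13) p. 259 L13–21: the translated integral «∫dU′↾_{Ω₁} δ((U′U₁)‾⋯) δ_{Ax}(U′U₁) χ₁ ⋯».

WHAT THIS FILE PROVES (no `sorry`, axioms standard; theorems only, LQB-only imports):
* `integral_comp_mulRight` — **«taking U = U′U₁»**: `∫ F(U) dU = ∫ F(U′·U₁) dU′` for EVERY `F` (right-invariance of `Π_b dU(b)`,
  LQB `AveragingRT.measurePreserving_mulRight`, no measurability of `F` needed thanks to the measurable-embedding form);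
* `fixTo_one_mulRight` — if the background is axial on the forest (`U₁(b) = 1` for `b ∈ T`), prescribing the forest variables commutes
  with the translation: `(U·U₁)[T := 1] = U[T := 1]·U₁`;
* `integral_fixTo_comp_mulRight` — the two combined: `∫ F(U[T := 1]) dU = ∫ F(U′[T := 1]·U₁) dU′` — the gauge-fixed Ω₁-integral of
  (10) (p1's `formula10_sum` integrand `(w·ρ₀)(fixTo T 1 U)·f(Ū(fixTo T 1 U))`) rewritten in the fluctuation variables of (13).
-/

namespace Summit.QuantumFields.Balaban3D.Proofs.Translation13

open _root_.MeasureTheory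
open Literature.MathematicalPhysics.QuantumFieldTheory.Balaban1983to89
open Literature.MathematicalPhysics.QuantumFieldTheory.Balaban1983to89.T4TreeGaugeFixing (fixTo)

variable {P : Params} {j : ℕ} {G : Type*} [GaugeGroup G] [MeasurableSpace G]

section Equiv

variable [MeasurableMul₂ G]

variable [HaarData G]

/-- **«taking U = U′U₁»** (p. 259 L4–5): for every function `F` of the configuration and every background `U₁`,
`∫ F(U) dU = ∫ F(U′·U₁) dU′` — right-invariance of the product Haar measure (`AveragingRT.measurePreserving_mulRight`) in the
measurable-embedding form (no measurability of `F` required). [cite: Balaban1985UV3, (12)–(13) p.259] -/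
theorem integral_comp_mulRight (U₁ : PBond P j → G) (F : GaugeField P j G → ℝ) :
    ∫ U, F (fun b => U b * U₁ b) ∂(fieldMeasure P j G) = ∫ U, F U ∂(fieldMeasure P j G) := by
  -- bondwise right multiplication is a measurable equivalence (Mathlib `MeasurableEquiv.piCongrRight` of `MeasurableEquiv.mulRight`)
  have hemb : MeasurableEmbedding (fun (U : GaugeField P j G) (b : PBond P j) => U b * U₁ b) :=
    (MeasurableEquiv.piCongrRight fun b : PBond P j => MeasurableEquiv.mulRight (U₁ b)).measurableEmbedding
  exact (AveragingRT.measurePreserving_mulRight U₁).integral_comp hemb F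

end Equiv

section FixTo

variable [DecidableEq (PBond P j)]

omit [MeasurableSpace G] in
/-- If the background is AXIAL on the gauge-fixing forest — `U₁(b) = 1` for `b ∈ T` ((12) p. 258 L36–37 «U satisfies axial gauge
conditions on Ω₁») — then prescribing the forest variables to 1 commutes with the translation: `(U·U₁)[T := 1] = U[T := 1]·U₁`.
[cite: Balaban1985UV3, (12)–(13) pp.258–259] -/
theorem fixTo_one_mulRight (T : Finset (PBond P j)) {U₁ : GaugeField P j G} (hU₁ : ∀ b ∈ T, U₁ b = 1) (U : GaugeField P j G) :
    fixTo T (1 : GaugeField P j G) (fun b => U b * U₁ b) = fun b => fixTo T (1 : GaugeField P j G) U b * U₁ b := by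
  funext b
  unfold fixTo
  by_cases hb : b ∈ T
  · simp only [hb, if_true, hU₁ b hb, mul_one]
  · simp only [hb, if_false]

variable [MeasurableMul₂ G] [HaarData G]

/-- **The gauge-fixed Ω₁-integral of (10) in the fluctuation variables of (13)**: for an axial background `U₁` (`= 1` on the forest `T`)
and every integrand `F`, `∫ F(U[T := 1]) dU = ∫ F(U′[T := 1]·U₁) dU′` — (10)'s `∫dU δ_{Ax}(U)⋯(U)` becomes (13)'s
`∫dU′ δ_{Ax}(U′U₁)⋯(U′U₁) = ∫dU′ δ_{Ax}(U′)⋯(U′U₁)`.  Kernel-checked. [cite: Balaban1985UV3, (13) p.259] -/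
theorem integral_fixTo_comp_mulRight (T : Finset (PBond P j)) {U₁ : GaugeField P j G} (hU₁ : ∀ b ∈ T, U₁ b = 1)
    (F : GaugeField P j G → ℝ) :
    ∫ U, F (fixTo T (1 : GaugeField P j G) U) ∂(fieldMeasure P j G)
      = ∫ U, F (fun b => fixTo T (1 : GaugeField P j G) U b * U₁ b) ∂(fieldMeasure P j G) := by
  rw [← integral_comp_mulRight U₁ (fun U => F (fixTo T (1 : GaugeField P j G) U))]
  refine integral_congr_ae (Filter.Eventually.of_forall fun U => ?_)
  simp only [fixTo_one_mulRight T hU₁ U]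

end FixTo

end Summit.QuantumFields.Balaban3D.Proofs.Translation13
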